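import Mathlib
import HarnessLib
import Summits.Ventures.LatticeQCDFlow.Exactness.SphereLuscherSeriesSolver

/-!
# The spectral sandwich for lattice polynomials on `S(E)^Λ`, any finite-dimensional `E` with `dim E ≥ 2`: `(d−1) ∫ (f − c)² dπ ≤ Σ_k ∫‖∂̃_k f‖² dπ ≤ N(N+d−2) ∫ f² dπ`

HONEST FRAMING: exact (Metropolis-corrected) sampling algorithms for lattice gauge theory;
figures of merit are autocorrelation/cost numbers at stated couplings and volumes; no
continuum-physics claim.

Venture `LatticeQCDFlow` (cell pub-lqcd), topic `Exactness`; FANOUT row 7 (`s0-cpn-null`: the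
S0-D1 rung — 2D CP⁹, Lüscher's LO trivializing map inside HMC, Engel–Schaefer 2011).  NEW WORK of
the cell over the tree's `Exactness/SphereLatticeLaplacianSelfAdjoint.lean` (orthonormal
eigenbasis of `𝔏₀` on `polyS N|_Ω` with eigenvalues among the labels; the Bernstein inequality)
and `Exactness/SphereLuscherSeriesSolver.lean` (`ker 𝔏₀ = ` constants on `polyS N|_Ω`); nothing is
cited as a fact.  Printed counterpart, NAMED ONLY: M. Lüscher, Commun. Math. Phys. 293 (2010) 899,
§3.3 ("the Laplacian is strictly positive on the orthogonal complement of the constant functions");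
Engel–Schaefer, Comput. Phys. Commun. 182 (2011) 2107, §3.  The tree's
`Exactness/SphereLatticePoincare.lean` proves the gap `d − 1` for ALL `C²` functionals when
`E = ℝ^{m+2}` (through the Literature sharp Poincaré inequality of the sphere); the present file
obtains it for LATTICE POLYNOMIALS on an ARBITRARY finite-dimensional inner product space `E`,
`dim E ≥ 2`, by pure algebra (the smallest nonzero label is `d − 1`).

## Content (`d = dim E ≥ 2`; `Λ` finite; `Ω = S(E)^Λ`, `π = ⊗_Λ volume.toSphere`)

* `inner_ge_of_eigenbasis` — Rayleigh lower bound from an orthonormal eigenbasis: if every nonzero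
  eigenvalue is `≥ m` then `⟪v, T v⟫ ≥ m ‖v − w‖²` for some `w` with `T w = 0`.
* **`poincare_polyS`** — THE SPECTRAL GAP FOR LATTICE POLYNOMIALS ON GENERAL `E`: for every
  `f ∈ polyS N` there is a constant `c₀` with `(d − 1) ∫ (f − c₀)² dπ ≤ Σ_k ∫ ‖∂̃_k f‖² dπ`;
  **`poincare_polyS_mean`** — the same with the mean, `(d−1)(∫ f² dπ − (∫ f dπ)²/π(Ω)) ≤ Σ_k ∫‖∂̃_k f‖²`.
* **`spectral_sandwich_polyS`** — both bounds at once: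
  `(d−1) ∫ (f − c₀)² dπ ≤ Σ_k ∫‖∂̃_k f‖² dπ ≤ N (N + d − 2) ∫ f² dπ`, CONSTANTS INDEPENDENT OF `Λ`.

NOT CLAIMED: the gap for non-polynomial functionals on general `E` (tree: `ℝ^{m+2}` only);
sharpness of `N(N + d − 2)`; anything about flows or the rung's numbers.
-/

noncomputable section

namespace Summit.Ventures.LatticeQCDFlow.Exactness

open Function Set Metric MeasureTheory
open scoped RealInnerProductSpace

/-! ## §1 A Rayleigh lower bound from an orthonormal eigenbasis -/

section Rayleigh

/-- **Rayleigh lower bound from an eigenbasis.**  If a symmetric `T` has an orthonormal eigenbasis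
`b` with eigenvalues `μ` and every NONZERO eigenvalue is `≥ m`, then for every `v` there
is `w` with `T w = 0` (the component of `v` in the kernel) and `m ‖v − w‖² ≤ ⟪v, T v⟫`. -/
theorem inner_ge_of_eigenbasis {V : Type*} [NormedAddCommGroup V] [InnerProductSpace ℝ V]
    {ι : Type*} [Fintype ι] [DecidableEq ι] (b : OrthonormalBasis ι ℝ V) {T : V →ₗ[ℝ] V}
    (hT : T.IsSymmetric) {μ : ι → ℝ} (hb : ∀ i, T (b i) = μ i • b i) {m : ℝ}
    (hM : ∀ i, μ i ≠ 0 → m ≤ μ i) (v : V) :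
    ∃ w : V, T w = 0 ∧ m * ‖v - w‖ ^ 2 ≤ ⟪v, T v⟫ := by
  set c : ι → ℝ := fun i => ⟪b i, v⟫
  refine ⟨∑ i, (if μ i = 0 then c i else 0) • b i, ?_, ?_⟩
  · rw [map_sum]
    refine Finset.sum_eq_zero fun i _ => ?_
    rw [map_smul, hb i, smul_smul]
    split_ifs with h
    · rw [h, mul_zero, zero_smul]
    · rw [zero_mul, zero_smul]
  · -- `⟪v, T v⟫ = Σ μ_i c_i²`
    have h1 : ⟪v, T v⟫ = ∑ i, μ i * c i ^ 2 := by
      rw [← b.sum_inner_mul_inner v (T v)]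
      refine Finset.sum_congr rfl fun i _ => ?_
      rw [← hT (b i) v, hb i, real_inner_smul_left, real_inner_comm (b i) v]
      ring
    -- `‖v − w‖² = Σ_{μ_i ≠ 0} c_i²`
    have hcoef : ∀ i, ⟪b i, v - ∑ j, (if μ j = 0 then c j else 0) • b j⟫ =
        if μ i = 0 then 0 else c i := by
      intro i
      rw [inner_sub_right, b.orthonormal.inner_right_fintype]
      split_ifs <;> simp [c]
    have h2 : ‖v - ∑ j, (if μ j = 0 then c j else 0) • b j‖ ^ 2 =
        ∑ i, (if μ i = 0 then 0 else c i) ^ 2 := by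
      rw [← real_inner_self_eq_norm_sq, ← b.sum_inner_mul_inner]
      refine Finset.sum_congr rfl fun i _ => ?_
      rw [real_inner_comm (b i), hcoef i, sq]
    rw [h1, h2, Finset.mul_sum]
    refine Finset.sum_le_sum fun i _ => ?_
    split_ifs with h
    · rw [h]; simp
    · exact mul_le_mul_of_nonneg_right (hM i h) (sq_nonneg _)

end Rayleigh

/-! ## §2 The spectral gap for lattice polynomials on general `E` -/

section Gap

variable {Λ : Type*} {E : Type*} [NormedAddCommGroup E] [InnerProductSpace ℝ E]
  [FiniteDimensional ℝ E] [MeasurableSpace E] [BorelSpace E]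
variable [Fintype Λ] [DecidableEq Λ]

omit [FiniteDimensional ℝ E] [MeasurableSpace E] [BorelSpace E] in
/-- **A nonzero label is at least `d − 1`** (`d ≥ 1`). -/
theorem le_of_eigLabel_ne_zero (h1 : 1 ≤ Module.finrank ℝ E) {k : ℕ} (κs : Fin k → SiteCoord Λ E)
    (h : eigLabel κs ≠ 0) : (Module.finrank ℝ E : ℝ) - 1 ≤ eigLabel κs := by
  rcases Nat.eq_zero_or_pos k with rfl | hk
  · exact absurd (eigLabel_fin_zero κs) h
  · exact le_eigLabel h1 hk κs

/-- **THE SPECTRAL GAP FOR LATTICE POLYNOMIALS ON A GENERAL `E`** (`dim E ≥ 2`).  For every lattice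
polynomial `f` of any degree there is a constant `c₀` with
`(d − 1) · ∫ (f − c₀)² dπ ≤ Σ_k ∫ ‖∂̃_k f‖² dπ` on the product of unit spheres. -/
theorem poincare_polyS (h2 : 2 ≤ Module.finrank ℝ E) {N : ℕ} {f : (Λ → E) → ℝ}
    (hf : f ∈ polyS Λ E N) : ∃ c₀ : ℝ,
      ((Module.finrank ℝ E : ℝ) - 1) *
          ∫ ω, (f (fun n => ((ω : Λ → sphere (0 : E) 1) n : E)) - c₀) ^ 2
            ∂Measure.pi (fun _ : Λ => (volume : Measure E).toSphere) ≤
        ∑ k, ∫ ω, ‖siteGrad k f (fun n => ((ω : Λ → sphere (0 : E) 1) n : E))‖ ^ 2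
          ∂Measure.pi (fun _ : Λ => (volume : Measure E).toSphere) := by
  haveI : Nontrivial E := Module.nontrivial_of_finrank_pos (R := ℝ) (by omega)
  obtain ⟨b, μ, hb, hμ⟩ := exists_orthonormal_eigenbasis_LΩ (Λ := Λ) (E := E) N
  have hM : ∀ i, μ i ≠ 0 → (Module.finrank ℝ E : ℝ) - 1 ≤ μ i := by
    intro i hi
    obtain ⟨k, -, κs, hk⟩ := hμ i
    rw [hk] at hi ⊢
    exact le_of_eigLabel_ne_zero (by omega) κs hi
  obtain ⟨w, hw0, hw⟩ := inner_ge_of_eigenbasis b (isSymmetric_LΩ N) hb hM (toV Λ E N ⟨f, hf⟩)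
  obtain ⟨c₀, hc₀⟩ := exists_const_of_LΩ_eq_zero h2 hw0
  refine ⟨c₀, ?_⟩
  have hn : ‖toV Λ E N ⟨f, hf⟩ - w‖ ^ 2 =
      ∫ ω, (f (fun n => ((ω : Λ → sphere (0 : E) 1) n : E)) - c₀) ^ 2
        ∂Measure.pi (fun _ : Λ => (volume : Measure E).toSphere) := by
    rw [← real_inner_self_eq_norm_sq, VΩ.inner_def]
    exact integral_congr_ae (ae_of_all _ fun ω => by
      simp only [VΩ.sub_apply, toV_apply, hc₀ ω, sq])
  rw [inner_LΩ_self, hn] at hw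
  exact hw

/-- **Both bounds at once**: for every lattice polynomial `f` of degree `≤ N` there is `c₀` with
`(d − 1) ∫ (f − c₀)² dπ ≤ Σ_k ∫ ‖∂̃_k f‖² dπ ≤ N (N + d − 2) ∫ f² dπ` — the Dirichlet form of
Lüscher's operator on lattice polynomials is pinched between two VOLUME-INDEPENDENT multiples of
`L²(π)` quantities (`dim E ≥ 2`). -/
theorem spectral_sandwich_polyS (h2 : 2 ≤ Module.finrank ℝ E) {N : ℕ} {f : (Λ → E) → ℝ}
    (hf : f ∈ polyS Λ E N) : ∃ c₀ : ℝ,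
      ((Module.finrank ℝ E : ℝ) - 1) *
          ∫ ω, (f (fun n => ((ω : Λ → sphere (0 : E) 1) n : E)) - c₀) ^ 2
            ∂Measure.pi (fun _ : Λ => (volume : Measure E).toSphere) ≤
        ∑ k, ∫ ω, ‖siteGrad k f (fun n => ((ω : Λ → sphere (0 : E) 1) n : E))‖ ^ 2
          ∂Measure.pi (fun _ : Λ => (volume : Measure E).toSphere) ∧
      ∑ k, ∫ ω, ‖siteGrad k f (fun n => ((ω : Λ → sphere (0 : E) 1) n : E))‖ ^ 2
          ∂Measure.pi (fun _ : Λ => (volume : Measure E).toSphere) ≤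
        (N : ℝ) * (N + (Module.finrank ℝ E : ℝ) - 2) *
          ∫ ω, f (fun n => ((ω : Λ → sphere (0 : E) 1) n : E)) ^ 2
            ∂Measure.pi (fun _ : Λ => (volume : Measure E).toSphere) := by
  haveI : Nontrivial E := Module.nontrivial_of_finrank_pos (R := ℝ) (by omega)
  obtain ⟨c₀, h⟩ := poincare_polyS h2 hf
  exact ⟨c₀, h, bernstein_polyS N hf⟩

/-- **The gap with the mean.**  For every lattice polynomial `f`,
`(d − 1) · (∫ f² dπ − (∫ f dπ)² / π(Ω)) ≤ Σ_k ∫ ‖∂̃_k f‖² dπ` (`dim E ≥ 2`; `π(Ω)` the total mass) —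
the constant shift minimising `∫ (f − c)² dπ` is the mean. -/
theorem poincare_polyS_mean (h2 : 2 ≤ Module.finrank ℝ E) {N : ℕ} {f : (Λ → E) → ℝ}
    (hf : f ∈ polyS Λ E N) :
    ((Module.finrank ℝ E : ℝ) - 1) *
        ((∫ ω, f (fun n => ((ω : Λ → sphere (0 : E) 1) n : E)) ^ 2
            ∂Measure.pi (fun _ : Λ => (volume : Measure E).toSphere)) -
          (∫ ω, f (fun n => ((ω : Λ → sphere (0 : E) 1) n : E))
            ∂Measure.pi (fun _ : Λ => (volume : Measure E).toSphere)) ^ 2 /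
            ((Measure.pi fun _ : Λ => (volume : Measure E).toSphere) univ).toReal) ≤
      ∑ k, ∫ ω, ‖siteGrad k f (fun n => ((ω : Λ → sphere (0 : E) 1) n : E))‖ ^ 2
        ∂Measure.pi (fun _ : Λ => (volume : Measure E).toSphere) := by
  haveI : Nontrivial E := Module.nontrivial_of_finrank_pos (R := ℝ) (by omega)
  obtain ⟨c₀, h⟩ := poincare_polyS h2 hf
  set P : Measure (Λ → sphere (0 : E) 1) := Measure.pi fun _ : Λ => (volume : Measure E).toSphere
  set F : (Λ → sphere (0 : E) 1) → ℝ := fun ω => f (fun n => (ω n : E))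
  have hFc : Continuous F := (contDiff_of_mem_polyS hf).continuous.comp continuous_sphereConfig
  have hF : Integrable F P := integrable_pi_toSphere_of_continuous hFc
  have hF2 : Integrable (fun ω => F ω ^ 2) P := integrable_pi_toSphere_of_continuous (hFc.pow 2)
  have hM : (P univ).toReal ≠ 0 := pi_toSphere_univ_toReal_ne_zero
  have hM0 : 0 < (P univ).toReal := lt_of_le_of_ne ENNReal.toReal_nonneg hM.symm
  -- expand `∫ (F − c₀)²`
  have hexp : ∫ ω, (F ω - c₀) ^ 2 ∂P =
      (∫ ω, F ω ^ 2 ∂P) - 2 * c₀ * (∫ ω, F ω ∂P) + c₀ ^ 2 * (P univ).toReal := by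
    have hA : Integrable (fun ω => F ω ^ 2 - 2 * c₀ * F ω) P := hF2.sub (hF.const_mul (2 * c₀))
    have s1 : ∫ ω, (F ω ^ 2 - 2 * c₀ * F ω) + c₀ ^ 2 ∂P =
        (∫ ω, (F ω ^ 2 - 2 * c₀ * F ω) ∂P) + ∫ _ω, c₀ ^ 2 ∂P := integral_add hA (integrable_const _)
    have s2 : ∫ ω, (F ω ^ 2 - 2 * c₀ * F ω) ∂P = (∫ ω, F ω ^ 2 ∂P) - ∫ ω, 2 * c₀ * F ω ∂P :=
      integral_sub hF2 (hF.const_mul (2 * c₀))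
    have s3 : ∫ ω, 2 * c₀ * F ω ∂P = 2 * c₀ * ∫ ω, F ω ∂P := integral_const_mul _ _
    have s4 : ∫ _ω, c₀ ^ 2 ∂P = c₀ ^ 2 * (P univ).toReal := by
      rw [integral_const, smul_eq_mul, measureReal_def, mul_comm]
    have e : (fun ω => (F ω - c₀) ^ 2) = fun ω => (F ω ^ 2 - 2 * c₀ * F ω) + c₀ ^ 2 := by
      funext ω; ring
    rw [e, s1, s2, s3, s4]
  -- the mean minimises: `∫F² − (∫F)²/M ≤ ∫ (F − c₀)²`
  have hmin : (∫ ω, F ω ^ 2 ∂P) - (∫ ω, F ω ∂P) ^ 2 / (P univ).toReal ≤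
      ∫ ω, (F ω - c₀) ^ 2 ∂P := by
    rw [hexp]
    have hsq : 0 ≤ (c₀ * (P univ).toReal - ∫ ω, F ω ∂P) ^ 2 / (P univ).toReal :=
      div_nonneg (sq_nonneg _) hM0.le
    have e : (∫ ω, F ω ^ 2 ∂P) - 2 * c₀ * (∫ ω, F ω ∂P) + c₀ ^ 2 * (P univ).toReal -
        ((∫ ω, F ω ^ 2 ∂P) - (∫ ω, F ω ∂P) ^ 2 / (P univ).toReal) =
        (c₀ * (P univ).toReal - ∫ ω, F ω ∂P) ^ 2 / (P univ).toReal := by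
      field_simp
      ring
    linarith
  have hd : (0 : ℝ) ≤ (Module.finrank ℝ E : ℝ) - 1 := by
    have : (2 : ℝ) ≤ Module.finrank ℝ E := by exact_mod_cast h2
    linarith
  exact le_trans (mul_le_mul_of_nonneg_left hmin hd) h

end Gap

end Summit.Ventures.LatticeQCDFlow.Exactness

end
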